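import Summits.AtomisticToContinuum.HydrodynamicLimit.Theorems.JParityClosureLocalSecondLawLedgerDefs
import Summits.AtomisticToContinuum.HydrodynamicLimit.Theorems.LocalSecondLaw.Negative.EquilibriumL1

/-!
# Vocabulary of the global-equilibrium instance of the crux `JParityClosure.LocalSecondLaw`
(stmt-AtomisticToContinuum-13081, line `exact-entropy-ledger-three-passivities`, lead c2 side composition)

Route-posited finite-`N` objects used by the registered equilibrium stubs `eq_*` of the picked line's skeleton
(`Cruxes/LocalSecondLaw/Lines/exact_entropy_ledger_three_passivities.lean`, §Equilibrium) and by its kernel-checked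
side composition `localSecondLawConst_of`, which proves the crux body VERBATIM at constant profiles `(a, ū, Θ)` (global
equilibrium, every horizon `τ`) from nine stubs by flow-invariance of the homogeneous law, Tonelli, and static `L¹`
estimates at one field point:

* `cutRho a = clamp(3 − a, 0, 1)` — continuous density cutoff, `= 1` for `a ≤ 2`, `= 0` for `a ≥ 3`: quarantines the
  bare-`limsup` equation of state above the band (it is inactive on the sup-density event);
* `cutTheta Θ b = clamp(2 − 4b/Θ, 0, 1)` — continuous cold cutoff, `= 1` for `b ≤ Θ/4`, `= 0` for `b ≥ Θ/2`;
* `HsT` — the cut entropy density `H(ρ_r, θ_r)·cutRho(ρ_r)` (equal to the crux's `Hs` wherever `ρ_r ≤ 2`);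
* `coldTerm Θ r w x = ρ_r (1 + log² θ_r) cutTheta Θ θ_r` — the cold-populated-ball statistic;
* `Ystat` — the static `L¹` distance integrand `|HsT − H̄| + ∑ₖ |HsT·m_k/ρ_r − H̄ ūₖ|`, `H̄ = Hs σ 1 Θ`;
* `Xtil`, `Xdet` — the cut crux integrand and its deterministic (constant-state) value; `Itil`, `Idet` their
  space–time integrals (same Bochner shape as `entropyFunctional`);
* `lawC σ a Θ ū N Φ` — the homogeneous local Gibbs law (an `abbrev` of `localGibbsLaw` at constant profiles).

Plus the vocabulary lemmas (ranges of the cutoffs, `HsT = Hs` below the cutoff, non-negativity, and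
`entropyFunctional = Itil` on the sup-density event).  Everything is built over the LANDED pieces of the crux
functional (`rhoC`, `momC`, `kinC`, `thetaC`, `Hs`, `entropyFunctional` of `Theorems/LocalSecondLaw/Negative/Functional.lean`)
and the line's `Flow`, `Phase`, `pD` (`Theorems/JParityClosureLocalSecondLawLedgerDefs.lean`).

References: H. Spohn, *Large Scale Dynamics of Interacting Particles* (1991), Part I §2.3, §3 (homogeneous Gibbs law,
setting); S. Goldstein, J. L. Lebowitz, *On the (Boltzmann) entropy of non-equilibrium systems*, Physica D 193 (2004)
53–66 (coarse-grained Boltzmann entropy of a macrostate; typicality at equilibrium).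
-/

noncomputable section

namespace Summit.AtomisticToContinuum.HydrodynamicLimit.Theorems.LocalSecondLawEquilibrium

open scoped BigOperators Topology Classical MeasureTheory ENNReal InnerProductSpace
open Filter Set MeasureTheory
open Literature.MathematicalPhysics.KineticTheory
open Literature.Analysis.FluidPDE
open Summit.AtomisticToContinuum.HydrodynamicLimit.Theorems.LocalSecondLawNegative
open Summit.AtomisticToContinuum.HydrodynamicLimit.Theorems.LocalSecondLawLedger

/-- Continuous density cutoff `clamp(3 − a, 0, 1)`: `1` on `a ≤ 2`, `0` on `a ≥ 3`, affine between. -/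
def cutRho (a : ℝ) : ℝ := max 0 (min 1 (3 - a))

/-- Continuous cold cutoff `clamp(2 − 4b/Θ, 0, 1)`: `1` on `b ≤ Θ/4`, `0` on `b ≥ Θ/2`, affine between. -/
def cutTheta (Θ b : ℝ) : ℝ := max 0 (min 1 (2 - 4 * b / Θ))

/-- The homogeneous (global-equilibrium) local Gibbs law: constant activity `a`, temperature `Θ`, drift `ū`. -/
abbrev lawC (σ a Θ : ℝ) (ū : V3) (N : ℕ) (Φ : Flow σ N) : Measure (Phase N) :=
  localGibbsLaw σ (fun _ => a) (fun _ => ū) (fun _ => Θ) N Φ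

variable {N : ℕ}

/-- The cut coarse entropy density `H(ρ_r, θ_r) · cutRho(ρ_r)` at the field point `x` of the configuration `w`
(equal to the crux's `Hs σ (ρ_r) (θ_r)` wherever `ρ_r ≤ 2`; the equation of state is only evaluated below `3σ³`). -/
def HsT (σ r : ℝ) (w : Phase N) (x : T3) : ℝ :=
  Hs σ (rhoC r w x) (thetaC r w x) * cutRho (rhoC r w x)

/-- The cold-populated-ball statistic `ρ_r (1 + log² θ_r) · cutTheta Θ θ_r` (supported on `θ_r < Θ/2`). -/
def coldTerm (Θ r : ℝ) (w : Phase N) (x : T3) : ℝ :=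
  rhoC r w x * (1 + Real.log (thetaC r w x) ^ 2) * cutTheta Θ (thetaC r w x)

/-- The static `L¹` integrand: distance of the cut entropy density and of the cut entropy flux coefficients from their
constant-state values `H̄ = Hs σ 1 Θ`, `H̄ ūₖ`. -/
def Ystat (σ Θ : ℝ) (ū : V3) (r : ℝ) (w : Phase N) (x : T3) : ℝ :=
  |HsT σ r w x - Hs σ 1 Θ| + ∑ k : Fin 3, |HsT σ r w x * (momC r w x k / rhoC r w x) - Hs σ 1 Θ * ū k|

/-- The cut crux integrand at time `s`, configuration `w`, field point `x` (the crux's integrand with `Hs` replaced by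
`HsT`; identical wherever `ρ_r ≤ 2`). -/
def Xtil (σ r : ℝ) (φ : ℝ → T3 → ℝ) (s : ℝ) (w : Phase N) (x : T3) : ℝ :=
  HsT σ r w x * (deriv (fun s' => φ s' x) s + ∑ k : Fin 3, momC r w x k / rhoC r w x * pD k (φ s) x)

/-- The deterministic (constant-state) value of the crux integrand: `H̄ (∂ₛφ + ū·∇φ)`. -/
def Xdet (σ Θ : ℝ) (ū : V3) (φ : ℝ → T3 → ℝ) (s : ℝ) (x : T3) : ℝ :=
  Hs σ 1 Θ * (deriv (fun s' => φ s' x) s + ∑ k : Fin 3, ū k * pD k (φ s) x)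

/-- The cut space–time functional along the flow (same Bochner shape as `entropyFunctional`). -/
def Itil (σ r τ : ℝ) (φ : ℝ → T3 → ℝ) (Φ : Flow σ N) (z : Phase N) : ℝ :=
  ∫ s in Set.Icc (0 : ℝ) τ, ∫ x : T3, Xtil σ r φ s (Φ.flow s z) x

/-- The deterministic space–time value `∫₀^τ ∫ H̄ (∂ₛφ + ū·∇φ)`. -/
def Idet (σ Θ : ℝ) (ū : V3) (τ : ℝ) (φ : ℝ → T3 → ℝ) : ℝ :=
  ∫ s in Set.Icc (0 : ℝ) τ, ∫ x : T3, Xdet σ Θ ū φ s x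

/-! ## Vocabulary lemmas -/

/-- The density cutoff is non-negative. -/
theorem cutRho_nonneg (a : ℝ) : 0 ≤ cutRho a := le_max_left _ _

/-- The density cutoff is at most `1`. -/
theorem cutRho_le_one (a : ℝ) : cutRho a ≤ 1 :=
  max_le zero_le_one (min_le_left _ _)

/-- The density cutoff is `1` below `2` (it is inactive on the sup-density event). -/
theorem cutRho_eq_one {a : ℝ} (h : a ≤ 2) : cutRho a = 1 := by
  unfold cutRho
  rw [min_eq_left (by linarith), max_eq_right zero_le_one]

/-- The density cutoff vanishes above `3` (the equation of state is never read above `3σ³`). -/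
theorem cutRho_eq_zero {a : ℝ} (h : 3 ≤ a) : cutRho a = 0 := by
  unfold cutRho
  rw [max_eq_left]
  exact min_le_of_right_le (by linarith)

/-- The density cutoff is continuous. -/
theorem continuous_cutRho : Continuous cutRho :=
  continuous_const.max (continuous_const.min (continuous_const.sub continuous_id))

/-- The density cutoff has absolute value at most `1`. -/
theorem abs_cutRho_le_one (a : ℝ) : |cutRho a| ≤ 1 := by
  rw [abs_of_nonneg (cutRho_nonneg a)]; exact cutRho_le_one a

/-- The cold cutoff is non-negative. -/
theorem cutTheta_nonneg (Θ b : ℝ) : 0 ≤ cutTheta Θ b := le_max_left _ _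

/-- The cold cutoff is at most `1`. -/
theorem cutTheta_le_one (Θ b : ℝ) : cutTheta Θ b ≤ 1 :=
  max_le zero_le_one (min_le_left _ _)

/-- The cold cutoff is `1` below `Θ/4`. -/
theorem cutTheta_eq_one {Θ b : ℝ} (hΘ : 0 < Θ) (h : b ≤ Θ / 4) : cutTheta Θ b = 1 := by
  unfold cutTheta
  have : 4 * b / Θ ≤ 1 := by rw [div_le_one hΘ]; linarith
  rw [min_eq_left (by linarith), max_eq_right zero_le_one]

/-- The cold cutoff vanishes above `Θ/2`. -/
theorem cutTheta_eq_zero {Θ b : ℝ} (hΘ : 0 < Θ) (h : Θ / 2 ≤ b) : cutTheta Θ b = 0 := by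
  unfold cutTheta
  have : 2 ≤ 4 * b / Θ := by rw [le_div_iff₀ hΘ]; linarith
  rw [max_eq_left]
  exact min_le_of_right_le (by linarith)

/-- The cold cutoff is continuous. -/
theorem continuous_cutTheta (Θ : ℝ) : Continuous (cutTheta Θ) :=
  continuous_const.max (continuous_const.min (continuous_const.sub
    ((continuous_const.mul continuous_id).div_const _)))

/-- Below the density cutoff the cut entropy density IS the crux's entropy density. -/
theorem HsT_eq_Hs {σ r : ℝ} {w : Phase N} {x : T3} (h : rhoC r w x ≤ 2) :
    HsT σ r w x = Hs σ (rhoC r w x) (thetaC r w x) := by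
  rw [HsT, cutRho_eq_one h, mul_one]

/-- Above `3` the cut entropy density vanishes. -/
theorem HsT_eq_zero {σ r : ℝ} {w : Phase N} {x : T3} (h : 3 ≤ rhoC r w x) : HsT σ r w x = 0 := by
  rw [HsT, cutRho_eq_zero h, mul_zero]

/-- The cut entropy density is dominated by the crux's entropy density. -/
theorem abs_HsT_le (σ r : ℝ) (w : Phase N) (x : T3) :
    |HsT σ r w x| ≤ |Hs σ (rhoC r w x) (thetaC r w x)| := by
  rw [HsT, abs_mul]
  exact mul_le_of_le_one_right (abs_nonneg _) (abs_cutRho_le_one _)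

/-- The cold-ball statistic is non-negative. -/
theorem coldTerm_nonneg {Θ r : ℝ} (hr : 0 < r) (w : Phase N) (x : T3) : 0 ≤ coldTerm Θ r w x :=
  mul_nonneg (mul_nonneg (rhoC_nonneg hr w x) (by positivity)) (cutTheta_nonneg _ _)

/-- The static `L¹` integrand is non-negative. -/
theorem Ystat_nonneg (σ Θ : ℝ) (ū : V3) (r : ℝ) (w : Phase N) (x : T3) : 0 ≤ Ystat σ Θ ū r w x :=
  add_nonneg (abs_nonneg _) (Finset.sum_nonneg fun _ _ => abs_nonneg _)

/-- Below the density cutoff the cut integrand IS the crux integrand. -/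
theorem Xtil_eq_of_rhoC_le {σ r : ℝ} (φ : ℝ → T3 → ℝ) (s : ℝ) {w : Phase N} {x : T3} (h : rhoC r w x ≤ 2) :
    Xtil σ r φ s w x = Hs σ (rhoC r w x) (thetaC r w x) *
      (deriv (fun s' => φ s' x) s + ∑ k : Fin 3, momC r w x k / rhoC r w x * pD k (φ s) x) := by
  rw [Xtil, HsT_eq_Hs h]

/-- **On the sup-density event the crux functional is the cut functional** (pointwise equality of the integrands at
every `(s, x) ∈ [0,τ] × 𝕋³`, so the two Bochner integrals agree whether honest or not). -/
theorem entropyFunctional_eq_Itil :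
    ∀ {N : ℕ} {σ r τ : ℝ} (φ : ℝ → T3 → ℝ) (Φ : Flow σ N) {z : Phase N}, (∀ s ∈ Set.Icc (0 : ℝ) τ, ∀ x : T3, rhoC r (Φ.flow s z) x ≤ 2) → entropyFunctional σ r τ φ Φ z = Itil σ r τ φ Φ z := by
  intro N σ r τ φ Φ z h
  unfold entropyFunctional Itil
  refine setIntegral_congr_fun measurableSet_Icc fun s hs => ?_
  refine integral_congr_ae (Eventually.of_forall fun x => ?_)
  exact (Xtil_eq_of_rhoC_le φ s (h s hs x)).symm

end Summit.AtomisticToContinuum.HydrodynamicLimit.Theorems.LocalSecondLawEquilibrium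

end
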